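import Literature.Analysis.Complex.RiemannSphereHolderSections
import Literature.Analysis.Complex.DbarAlongHolomorphic
import Literature.Analysis.FunctionSpaces.ContDiffHolderFDerivCLM
import Literature.Analysis.FunctionSpaces.ContDiffHolderDiffOperator
import Literature.Analysis.FunctionSpaces.ContDiffHolderBilinear
import Literature.Analysis.FunctionSpaces.ContDiffHolderLocalization
import Mathlib.Analysis.Complex.CauchyIntegral
import HarnessLib

/-!
# The `∂̄` operator on Hölder sections of line bundles over the Riemann sphere

Topic `Literature/Analysis/Complex`. Layer B2a of the analytic core of the local-foliation theorem
for embedded `J`-spheres (Wendl 2018, Thm. 2.46 and Prop. 2.53): the Cauchy–Riemann operator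
`∂̄ = ∂/∂z̄` acting on the Hölder spaces `𝓗^{k+1,r}_τ(F)` of sections of the line bundle with
(holomorphic, zero-free) clutching function `τ` over `S² = ℂ_z ∪ ℂ_w`, `w = z⁻¹`, of
`Literature/Analysis/Complex/RiemannSphereHolderSections.lean`.

If `f₁ w = τ w • f₀ w⁻¹` with `τ` holomorphic, then (chain rule along the anti-holomorphic
differential of `w ↦ w⁻¹`, `dbarAlong_one_comp_of_hasDerivAt`)

  `∂̄ f₁ (w) = -τ w (conj w)⁻² • (∂̄ f₀)(w⁻¹) = dbarClutch τ w • (∂̄ f₀)(w⁻¹)`,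

so `∂̄` maps sections of the bundle `τ` to sections of the bundle `dbarClutch τ` (the bundle of
`(0,1)`-forms with values in `τ`; `τ = 1`: `f₀ dz̄ = f₁ dw̄`, clutching `-(conj w)⁻²`).

* `RiemannSphere.dbarClutch τ` — the clutching function `w ↦ -τ w (conj w)⁻²`, zero-free and
  smooth off the origin; the two instances used downstream, `τ = 1` (functions; `dbarClutch_one`)
  and `τ w = -w²` (vector fields; `dbarClutch_neg_sq`), with their standing hypotheses
  (`one_clutch_ne_zero`, `differentiableOn_one_clutch`, `neg_sq_clutch_ne_zero`,
  `differentiableOn_neg_sq_clutch`);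
* `RiemannSphere.dbarAlong_sec₁` — the displayed clutching relation for the chart representatives
  `sec₀`, `sec₁` of a member of `𝓗^{k+1,r}_τ`;
* `RiemannSphere.cutSec₀CLM`, `cutSec₁CLM` — the chart representatives cut off at radius `4`/`5`,
  `p ↦ ρ₄ • sec₀ p`, as bounded operators `𝓗^{k,r}_τ →L C^{k,r}_b(ℂ, F)` (membership: the
  representative is the first piece on `‖z‖ ≤ 1` and the transferred second piece
  `(τ z⁻¹)⁻¹ • g₁ (z⁻¹)` on `‖z‖ ≥ 1`, glued by a cutoff, using localized pre-composition and
  smooth coefficients from `ContDiffHolderLocalization.lean`; continuity: closed graph);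
* `RiemannSphere.dbarCLM` — `∂̄ : C^{k+1,r}_b(ℂ, F) →L C^{k,r}_b(ℂ, F)`;
* `RiemannSphere.dbarSec hτ hτh hr : 𝓗^{k+1,r}_τ →L[ℝ] 𝓗^{k,r}_{dbarClutch τ}` — **the operator
  `∂̄`**, with pieces `(ρ • ∂̄ sec₀, ρ • ∂̄ sec₁)`, and the chart formulas
  `sec₀ (dbarSec p) = ∂̄ (sec₀ p)`, `sec₁ (dbarSec p) = ∂̄ (sec₁ p)` on all of `ℂ`
  (`sec₀_dbarSec`, `sec₁_dbarSec`);
* `RiemannSphere.ext_of_sec₀_sec₁` — members agree iff their representatives agree on the two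
  discs `‖z‖ < 2`, `‖w‖ < 2`;
* `RiemannSphere.SmoothSection.dbar`, `dbarSec_toHolder` — `∂̄` of a smooth section.

Everything is proved; no named facts. The spaces are real Banach spaces and `dbarSec` is only
asserted real-linear; the standing hypotheses on `τ` (zero-free, holomorphic off the origin) and
`r ≤ 1` are explicit arguments. Not here: right inverses and the kernel of `∂̄` (Cauchy
transforms), zeroth-order perturbations, the similarity principle.

## References

* C. Wendl, *Holomorphic Curves in Low Dimensions*, LNM 2216 (2018), §2.1.3, Thm. 2.46,
  Prop. 2.53. [Wendl2018]
* D. D. Joyce, *Riemannian Holonomy Groups and Calibrated Geometry* (2007), §1.2. [Joyce2007]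
* L. Hörmander, *An Introduction to Complex Analysis in Several Variables*, 2nd ed. (1973), §1.1.
  [HormanderSCV1973]
-/

noncomputable section

open Set Filter Metric Function Complex
open scoped Topology NNReal ContDiff ComplexConjugate

namespace Literature.Analysis.Complex

namespace RiemannSphere

open Literature.Analysis.FunctionSpaces

/-! ### `∂̄` along the inversion and the clutching function of `(0,1)`-forms -/

section ChainRule

variable {F : Type*} [NormedAddCommGroup F] [NormedSpace ℂ F]

/-- **Chain rule for `∂/∂z̄` along a holomorphic map**: if `h` has complex derivative `h'` at `w`
and `f` is real-differentiable at `h w`, then `∂̄ (f ∘ h) (w) = conj h' • (∂̄ f)(h w)` (the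
differential of `h` is multiplication by `h'`, and `∂̄` is conjugate-linear in the direction).
[folklore] -/
theorem dbarAlong_one_comp_of_hasDerivAt {f : ℂ → F} {h : ℂ → ℂ} {h' w : ℂ}
    (hh : HasDerivAt h h' w) (hf : DifferentiableAt ℝ f (h w)) :
    dbarAlong 1 (fun y => f (h y)) w = conj h' • dbarAlong 1 f (h w) := by
  have H : HasFDerivAt (fun y => f (h y))
      ((fderiv ℝ f (h w)).comp (h' • (1 : ℂ →L[ℝ] ℂ))) w :=
    hf.hasFDerivAt.comp w hh.complexToReal_fderiv
  have key : dbarAlong 1 (fun y => f (h y)) w = dbarAlong h' f (h w) := by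
    rw [dbarAlong_one, dbarAlong_apply, H.fderiv]
    simp [mul_comm]
  rw [key, ← dbarAlong_smul_left, smul_eq_mul, mul_one]

/-- **The clutching function of the bundle of `(0,1)`-forms with values in the line bundle of
clutching function `τ`**: `dbarClutch τ w = -τ w · (conj w)⁻²`
(from `∂̄_w (f (w⁻¹)) = -(conj w)⁻² (∂̄ f)(w⁻¹)`). [folklore] -/
def dbarClutch (τ : ℂ → ℂ) : ℂ → ℂ := fun w => -(τ w * ((starRingEnd ℂ) w)⁻¹ ^ 2)

/-- Unfolding of `dbarClutch`. [folklore] -/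
theorem dbarClutch_apply (τ : ℂ → ℂ) (w : ℂ) :
    dbarClutch τ w = -(τ w * ((starRingEnd ℂ) w)⁻¹ ^ 2) := rfl

/-- `dbarClutch τ` is zero-free off the origin where `τ` is. [folklore] -/
theorem dbarClutch_ne_zero {τ : ℂ → ℂ} {w : ℂ} (hτ : τ w ≠ 0) (hw : w ≠ 0) :
    dbarClutch τ w ≠ 0 := by
  rw [dbarClutch_apply, neg_ne_zero]
  exact mul_ne_zero hτ (pow_ne_zero _ (inv_ne_zero ((map_ne_zero _).2 hw)))

/-- The standing zero-freeness hypothesis passes from `τ` to `dbarClutch τ`. [folklore] -/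
theorem dbarClutch_ne_zero_of {τ : ℂ → ℂ} (hτ : ∀ w, w ≠ 0 → τ w ≠ 0) :
    ∀ w, w ≠ 0 → dbarClutch τ w ≠ 0 := fun w hw => dbarClutch_ne_zero (hτ w hw) hw

/-- `dbarClutch τ` is real-smooth off the origin where `τ` is. [folklore] -/
theorem contDiffOn_dbarClutch {τ : ℂ → ℂ} (hτs : ContDiffOn ℝ ∞ τ {w | w ≠ 0}) :
    ContDiffOn ℝ ∞ (dbarClutch τ) {w | w ≠ 0} := by
  have hc : ContDiffOn ℝ ∞ (fun w : ℂ => ((starRingEnd ℂ) w)⁻¹) {w | w ≠ 0} := by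
    intro w hw
    have h1 : ContDiffAt ℝ ∞ (fun w : ℂ => ((starRingEnd ℂ) w)⁻¹) w :=
      (((contDiffAt_inv ℂ ((map_ne_zero _).2 hw)).restrict_scalars ℝ).comp w
        Complex.conjCLE.contDiff.contDiffAt)
    exact h1.contDiffWithinAt
  exact (hτs.mul (hc.pow 2)).neg

/-- The bundle of `(0,1)`-forms (`τ = 1`, functions): clutching `w ↦ -(conj w)⁻²`. [folklore] -/
theorem dbarClutch_one : dbarClutch 1 = fun w => -((starRingEnd ℂ) w)⁻¹ ^ 2 := by
  funext w
  simp [dbarClutch_apply]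

/-- The bundle of `(0,1)`-forms with values in the tangent bundle (`τ w = -w²`): clutching
`w ↦ w² (conj w)⁻²`. [folklore] -/
theorem dbarClutch_neg_sq :
    dbarClutch (fun w => -w ^ 2) = fun w => w ^ 2 * ((starRingEnd ℂ) w)⁻¹ ^ 2 := by
  funext w
  simp [dbarClutch_apply]

/-- The trivial clutching `τ = 1` is zero-free off the origin. [folklore] -/
theorem one_clutch_ne_zero : ∀ w : ℂ, w ≠ 0 → (1 : ℂ → ℂ) w ≠ 0 := fun _ _ => one_ne_zero

/-- The trivial clutching `τ = 1` is holomorphic off the origin. [folklore] -/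
theorem differentiableOn_one_clutch : DifferentiableOn ℂ (1 : ℂ → ℂ) {w | w ≠ 0} :=
  differentiableOn_const (c := (1 : ℂ))

/-- The tangent clutching `τ w = -w²` is zero-free off the origin. [folklore] -/
theorem neg_sq_clutch_ne_zero : ∀ w : ℂ, w ≠ 0 → (fun w : ℂ => -w ^ 2) w ≠ 0 :=
  fun _ hw => neg_ne_zero.2 (pow_ne_zero 2 hw)

/-- The tangent clutching `τ w = -w²` is holomorphic off the origin. [folklore] -/
theorem differentiableOn_neg_sq_clutch : DifferentiableOn ℂ (fun w : ℂ => -w ^ 2) {w | w ≠ 0} :=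
  (differentiable_pow 2).neg.differentiableOn

/-- A function holomorphic off the origin is real-smooth off the origin. [folklore] -/
theorem contDiffOn_real_of_differentiableOn {τ : ℂ → ℂ}
    (hτh : DifferentiableOn ℂ τ {w | w ≠ 0}) : ContDiffOn ℝ ∞ τ {w | w ≠ 0} :=
  (hτh.contDiffOn isOpen_ne_zero).restrict_scalars ℝ

/-- **`∂̄` of a clutched function**: if `g = τ • (f ∘ inv)` near `w ≠ 0` with `τ` complex
differentiable at `w` and `f` real-differentiable at `w⁻¹`, then
`∂̄ g (w) = dbarClutch τ w • (∂̄ f)(w⁻¹)` (`∂̄ τ = 0`, Leibniz, and the chain rule along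
`w ↦ w⁻¹`, whose derivative is `-w⁻²`). [folklore] -/
theorem dbarAlong_one_of_eventuallyEq_smul_comp_inv {τ : ℂ → ℂ} {f g : ℂ → F} {w : ℂ}
    (hw : w ≠ 0) (hτw : DifferentiableAt ℂ τ w) (hf : DifferentiableAt ℝ f w⁻¹)
    (hg : g =ᶠ[𝓝 w] fun y => τ y • f y⁻¹) :
    dbarAlong 1 g w = dbarClutch τ w • dbarAlong 1 f w⁻¹ := by
  rw [dbarAlong_congr_of_eventuallyEq hg 1]
  have hfi : DifferentiableAt ℝ (fun y : ℂ => f y⁻¹) w :=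
    hf.comp w ((hasDerivAt_inv hw).differentiableAt.restrictScalars ℝ)
  rw [dbarAlong_smul (hτw.restrictScalars ℝ) hfi, dbarAlong_eq_zero_of_differentiableAt hτw,
    zero_smul, zero_add, dbarAlong_one_comp_of_hasDerivAt (hasDerivAt_inv hw) hf, smul_smul]
  congr 1
  rw [dbarClutch_apply, map_neg, map_inv₀, map_pow, inv_pow, mul_neg]

end ChainRule

/-! ### Chart representatives: linearity, `∂̄`-clutching, extensionality -/

section Sections

variable {F : Type} [NormedAddCommGroup F] [NormedSpace ℂ F] {τ : ℂ → ℂ} {k : ℕ} {r : ℝ≥0}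

/-- `sec₀` is additive in the pair of pieces. [folklore] -/
theorem sec₀_add (p q : ContDiffHolderFunction ℂ F k r × ContDiffHolderFunction ℂ F k r) (z : ℂ) :
    sec₀ τ (p + q) z = sec₀ τ p z + sec₀ τ q z := by
  by_cases hz : ‖z‖ < 2 <;> simp [sec₀, hz, smul_add]

/-- `sec₀` is real-homogeneous in the pair of pieces. [folklore] -/
theorem sec₀_smul (c : ℝ) (p : ContDiffHolderFunction ℂ F k r × ContDiffHolderFunction ℂ F k r)
    (z : ℂ) : sec₀ τ (c • p) z = c • sec₀ τ p z := by
  by_cases hz : ‖z‖ < 2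
  · simp [sec₀, hz]
  · simp [sec₀, hz, smul_comm c]

/-- `sec₁` is additive in the pair of pieces. [folklore] -/
theorem sec₁_add (p q : ContDiffHolderFunction ℂ F k r × ContDiffHolderFunction ℂ F k r) (w : ℂ) :
    sec₁ τ (p + q) w = sec₁ τ p w + sec₁ τ q w := by
  by_cases hw : ‖w‖ < 2 <;> simp [sec₁, hw, smul_add]

/-- `sec₁` is real-homogeneous in the pair of pieces. [folklore] -/
theorem sec₁_smul (c : ℝ) (p : ContDiffHolderFunction ℂ F k r × ContDiffHolderFunction ℂ F k r)
    (w : ℂ) : sec₁ τ (c • p) w = c • sec₁ τ p w := by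
  by_cases hw : ‖w‖ < 2
  · simp [sec₁, hw]
  · simp [sec₁, hw, smul_comm c]

section Member

variable {p : ContDiffHolderFunction ℂ F (k + 1) r × ContDiffHolderFunction ℂ F (k + 1) r}

/-- **`∂̄` intertwines the clutchings `τ` and `dbarClutch τ`**: for a member of `𝓗^{k+1,r}_τ`
with `τ` holomorphic and zero-free off the origin,
`∂̄ (sec₁ p) (w) = dbarClutch τ w • ∂̄ (sec₀ p) (w⁻¹)` for `w ≠ 0`. [folklore] -/
theorem dbarAlong_sec₁ (hp : p ∈ holderSections F τ (k + 1) r) (hτ : ∀ w, w ≠ 0 → τ w ≠ 0)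
    (hτh : DifferentiableOn ℂ τ {w | w ≠ 0}) {w : ℂ} (hw : w ≠ 0) :
    dbarAlong 1 (sec₁ τ p) w = dbarClutch τ w • dbarAlong 1 (sec₀ τ p) w⁻¹ := by
  have hev : sec₁ τ p =ᶠ[𝓝 w] fun y => τ y • sec₀ τ p y⁻¹ := by
    filter_upwards [isOpen_ne_zero.mem_nhds hw] with y hy
    exact sec₁_eq_smul_sec₀ hp hτ hy
  have hf : DifferentiableAt ℝ (sec₀ τ p) w⁻¹ :=
    (contDiff_sec₀ hp hτ (contDiffOn_real_of_differentiableOn hτh)).differentiable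
      (by exact_mod_cast Nat.succ_ne_zero k) _
  exact dbarAlong_one_of_eventuallyEq_smul_comp_inv hw
    (hτh.differentiableAt (isOpen_ne_zero.mem_nhds hw)) hf hev

/-- The inverse form: `∂̄ (sec₀ p) (z) = (dbarClutch τ z⁻¹)⁻¹ • ∂̄ (sec₁ p) (z⁻¹)` for `z ≠ 0`.
[folklore] -/
theorem dbarAlong_sec₀ (hp : p ∈ holderSections F τ (k + 1) r) (hτ : ∀ w, w ≠ 0 → τ w ≠ 0)
    (hτh : DifferentiableOn ℂ τ {w | w ≠ 0}) {z : ℂ} (hz : z ≠ 0) :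
    dbarAlong 1 (sec₀ τ p) z = (dbarClutch τ z⁻¹)⁻¹ • dbarAlong 1 (sec₁ τ p) z⁻¹ := by
  rw [dbarAlong_sec₁ hp hτ hτh (inv_ne_zero hz), inv_inv, smul_smul,
    inv_mul_cancel₀ (dbarClutch_ne_zero (hτ _ (inv_ne_zero hz)) (inv_ne_zero hz)), one_smul]

end Member

/-- **Extensionality by representatives**: two members of `𝓗^{k,r}_τ` whose `z`-representatives
agree on the disc `‖z‖ < 2` and whose `w`-representatives agree on the disc `‖w‖ < 2` are equal
(the two discs cover the sphere, and the pieces are `ρ • sec₀`, `ρ • sec₁`). [folklore] -/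
theorem ext_of_sec₀_sec₁ {p q : holderSections F τ k r} (hτ : ∀ w, w ≠ 0 → τ w ≠ 0)
    (h₀ : ∀ z, ‖z‖ < 2 → sec₀ τ (p : ContDiffHolderFunction ℂ F k r ×
      ContDiffHolderFunction ℂ F k r) z = sec₀ τ (q : ContDiffHolderFunction ℂ F k r ×
      ContDiffHolderFunction ℂ F k r) z)
    (h₁ : ∀ w, ‖w‖ < 2 → sec₁ τ (p : ContDiffHolderFunction ℂ F k r ×
      ContDiffHolderFunction ℂ F k r) w = sec₁ τ (q : ContDiffHolderFunction ℂ F k r ×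
      ContDiffHolderFunction ℂ F k r) w) : p = q := by
  have hinv : ∀ z : ℂ, ¬‖z‖ < 2 → z ≠ 0 ∧ ‖z⁻¹‖ < 2 := fun z hz => by
    have hz' : (2 : ℝ) ≤ ‖z‖ := not_lt.1 hz
    refine ⟨fun h => absurd hz' (by rw [h, norm_zero]; norm_num), ?_⟩
    rw [norm_inv]
    calc ‖z‖⁻¹ ≤ (2 : ℝ)⁻¹ := inv_anti₀ (by norm_num) hz'
      _ < 2 := by norm_num
  have key₀ : ∀ z, sec₀ τ (p : ContDiffHolderFunction ℂ F k r × ContDiffHolderFunction ℂ F k r) z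
      = sec₀ τ (q : ContDiffHolderFunction ℂ F k r × ContDiffHolderFunction ℂ F k r) z := by
    intro z
    by_cases hz : ‖z‖ < 2
    · exact h₀ z hz
    · obtain ⟨hz0, hzi⟩ := hinv z hz
      rw [sec₀_eq_smul_sec₁ p.2 hτ hz0, sec₀_eq_smul_sec₁ q.2 hτ hz0, h₁ _ hzi]
  have key₁ : ∀ w, sec₁ τ (p : ContDiffHolderFunction ℂ F k r × ContDiffHolderFunction ℂ F k r) w
      = sec₁ τ (q : ContDiffHolderFunction ℂ F k r × ContDiffHolderFunction ℂ F k r) w := by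
    intro w
    by_cases hw : ‖w‖ < 2
    · exact h₁ w hw
    · obtain ⟨hw0, hwi⟩ := hinv w hw
      rw [sec₁_eq_smul_sec₀ p.2 hτ hw0, sec₁_eq_smul_sec₀ q.2 hτ hw0, h₀ _ hwi]
  apply Subtype.ext
  apply Prod.ext
  · exact ContDiffHolderFunction.ext fun z => by
      rw [fst_eq_rhoCut_smul_sec₀ p.2, fst_eq_rhoCut_smul_sec₀ q.2, key₀]
  · exact ContDiffHolderFunction.ext fun w => by
      rw [snd_eq_rhoCut_smul_sec₁ p.2, snd_eq_rhoCut_smul_sec₁ q.2, key₁]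

/-! ### `∂̄` of smooth sections -/

namespace SmoothSection

variable (s : SmoothSection F τ)

/-- **`∂̄` of a smooth section**: the pair `(∂̄ f₀, ∂̄ f₁)`, a smooth section of the bundle
`dbarClutch τ` (`τ` holomorphic off the origin). [folklore] -/
def dbar (hτh : DifferentiableOn ℂ τ {w | w ≠ 0}) : SmoothSection F (dbarClutch τ) where
  f₀ := dbarAlong 1 s.f₀
  f₁ := dbarAlong 1 s.f₁
  smooth₀ := contDiff_infty_dbarAlong s.smooth₀ 1
  smooth₁ := contDiff_infty_dbarAlong s.smooth₁ 1
  clutch w hw := by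
    have hev : s.f₁ =ᶠ[𝓝 w] fun y => τ y • s.f₀ y⁻¹ := by
      filter_upwards [isOpen_ne_zero.mem_nhds hw] with y hy using s.clutch y hy
    exact dbarAlong_one_of_eventuallyEq_smul_comp_inv hw
      (hτh.differentiableAt (isOpen_ne_zero.mem_nhds hw))
      ((s.smooth₀.differentiable (by simp)).differentiableAt) hev

/-- The `z`-representative of `∂̄ s` is `∂̄ f₀`. [folklore] -/
@[simp]
theorem dbar_f₀ (hτh : DifferentiableOn ℂ τ {w | w ≠ 0}) : (s.dbar hτh).f₀ = dbarAlong 1 s.f₀ :=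
  rfl

/-- The `w`-representative of `∂̄ s` is `∂̄ f₁`. [folklore] -/
@[simp]
theorem dbar_f₁ (hτh : DifferentiableOn ℂ τ {w | w ≠ 0}) : (s.dbar hτh).f₁ = dbarAlong 1 s.f₁ :=
  rfl

end SmoothSection

/-! ### Two more cutoffs -/

/-- The bump behind `χ`: radii `1 < 3/2` about `0 ∈ ℂ`. [folklore] -/
def chiCutBump : ContDiffBump (0 : ℂ) := ⟨1, 3 / 2, by norm_num, by norm_num⟩

/-- **The inner cutoff `χ`**: smooth, `= 1` on `‖z‖ ≤ 1`, `= 0` on `‖z‖ ≥ 3/2`. [folklore] -/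
def chiCut (z : ℂ) : ℝ := chiCutBump z

/-- `χ = 1` on the closed unit disc. [folklore] -/
theorem chiCut_eq_one {z : ℂ} (hz : ‖z‖ ≤ 1) : chiCut z = 1 :=
  chiCutBump.one_of_mem_closedBall (by simpa [chiCutBump] using hz)

/-- `χ = 0` off the open disc of radius `3/2`. [folklore] -/
theorem chiCut_eq_zero {z : ℂ} (hz : 3 / 2 ≤ ‖z‖) : chiCut z = 0 :=
  chiCutBump.zero_of_le_dist (by simpa [chiCutBump] using hz)

/-- `χ` is smooth. [folklore] -/
theorem contDiff_chiCut : ContDiff ℝ ∞ chiCut := chiCutBump.contDiff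

/-- `χ` has compact support. [folklore] -/
theorem hasCompactSupport_chiCut : HasCompactSupport chiCut := chiCutBump.hasCompactSupport

/-- The bump behind `ρ₄`: radii `4 < 5` about `0 ∈ ℂ`. [folklore] -/
def rhoCut₄Bump : ContDiffBump (0 : ℂ) := ⟨4, 5, by norm_num, by norm_num⟩

/-- **The outer cutoff `ρ₄`**: smooth, compactly supported, `= 1` on `‖z‖ ≤ 4` (a neighbourhood
of the support of `ρ`). [folklore] -/
def rhoCut₄ (z : ℂ) : ℝ := rhoCut₄Bump z

/-- `ρ₄ = 1` on the closed disc of radius `4`. [folklore] -/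
theorem rhoCut₄_eq_one {z : ℂ} (hz : ‖z‖ ≤ 4) : rhoCut₄ z = 1 :=
  rhoCut₄Bump.one_of_mem_closedBall (by simpa [rhoCut₄Bump] using hz)

/-- `ρ₄` is smooth. [folklore] -/
theorem contDiff_rhoCut₄ : ContDiff ℝ ∞ rhoCut₄ := rhoCut₄Bump.contDiff

/-- `ρ₄` has compact support. [folklore] -/
theorem hasCompactSupport_rhoCut₄ : HasCompactSupport rhoCut₄ := rhoCut₄Bump.hasCompactSupport

/-! ### Smooth complex coefficients on an open set -/

/-- **Smooth complex coefficients**: a coefficient `a : ℂ → ℂ` of class `C^∞` on an open set `U`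
times a member `v ∈ C^{k,r}_b(ℂ, F)` with compact support inside `U` is a member (`r ≤ 1`;
the complex-scalar version of `MemContDiffHolder.smul_of_contDiffOn`). [folklore] -/
theorem memContDiffHolder_smul_of_contDiffOn (hr : r ≤ 1) {v : ℂ → F}
    (hv : MemContDiffHolder k r v) (hvs : HasCompactSupport v) {a : ℂ → ℂ} {U : Set ℂ}
    (hU : IsOpen U) (ha : ContDiffOn ℝ ∞ a U) (hvU : tsupport v ⊆ U) :
    MemContDiffHolder k r fun y => a y • v y := by
  obtain ⟨ψ, hψ, hψs, hψU, hψ1, -⟩ := exists_contDiff_one_nhdsSet_of_isCompact hvs hU hvU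
  set a' : ℂ → ℂ := fun y => ψ y • a y with ha'
  have ha'smooth : ContDiff ℝ ∞ a' := ContDiff.smul_of_contDiffOn hψ hU ha hψU
  have ha'supp : HasCompactSupport a' := hψs.smul_right
  have ha'mem : MemContDiffHolder k r a' :=
    MemContDiffHolder.of_contDiff_of_hasCompactSupport ha'smooth ha'supp hr
  have hprod : MemContDiffHolder k r fun y =>
      (ContinuousLinearMap.lsmul ℝ ℂ : ℂ →L[ℝ] F →L[ℝ] F) (a' y) (v y) :=
    ha'mem.bilinear hr (ContinuousLinearMap.lsmul ℝ ℂ) hv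
  have heq : (fun y => a y • v y) = fun y =>
      (ContinuousLinearMap.lsmul ℝ ℂ : ℂ →L[ℝ] F →L[ℝ] F) (a' y) (v y) := by
    funext y
    rw [ContinuousLinearMap.lsmul_apply]
    by_cases hy : v y = 0
    · simp [hy]
    · have hyK : y ∈ tsupport v := subset_closure (Function.mem_support.2 hy)
      have h1 : ψ y = 1 := hψ1.self_of_nhdsSet y hyK
      simp [ha', h1]
  rw [heq]
  exact hprod

/-! ### The cut-off representatives as members of `C^{k,r}_b` -/

section CutSec

variable {p : ContDiffHolderFunction ℂ F k r × ContDiffHolderFunction ℂ F k r}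

/-- The glueing cutoff `χ₁ = ρ₄ (1 - χ)`: smooth. [folklore] -/
theorem contDiff_rhoCut₄_mul_one_sub_chiCut :
    ContDiff ℝ ∞ fun z : ℂ => rhoCut₄ z * (1 - chiCut z) :=
  contDiff_rhoCut₄.mul (contDiff_const.sub contDiff_chiCut)

/-- The glueing cutoff `χ₁ = ρ₄ (1 - χ)` is supported in `‖z‖ ≥ 1`, inside the open set
`‖z‖ > 1/2`. [folklore] -/
theorem tsupport_rhoCut₄_mul_one_sub_chiCut_subset :
    tsupport (fun z : ℂ => rhoCut₄ z * (1 - chiCut z)) ⊆ {z : ℂ | 2⁻¹ < ‖z‖} := by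
  have hcl : IsClosed {z : ℂ | 1 ≤ ‖z‖} := isClosed_le continuous_const continuous_norm
  refine (closure_minimal (fun z hz => ?_) hcl).trans fun z (hz : 1 ≤ ‖z‖) =>
    lt_of_lt_of_le (by norm_num : (2 : ℝ)⁻¹ < 1) hz
  rw [mem_setOf_eq]
  by_contra h
  refine hz ?_
  simp [chiCut_eq_one (not_le.1 h).le]

/-- **The `z`-representative cut off at radius `4`/`5` is in `C^{k,r}_b`**: on `‖z‖ ≤ 1` it is
the first piece, on `‖z‖ ≥ 1` the transferred second piece `(τ z⁻¹)⁻¹ • g₁ (z⁻¹)` (a smooth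
complex coefficient times a localized pre-composition of a member with the inversion), the two
glued by `χ`. [cite: Joyce2007, §1.2] -/
theorem memContDiffHolder_rhoCut₄_smul_sec₀ (hp : p ∈ holderSections F τ k r)
    (hτ : ∀ w, w ≠ 0 → τ w ≠ 0) (hτs : ContDiffOn ℝ ∞ τ {w | w ≠ 0}) (hr : r ≤ 1) :
    MemContDiffHolder k r fun z => (rhoCut₄ z : ℂ) • sec₀ τ p z := by
  set U : Set ℂ := {z | 2⁻¹ < ‖z‖}
  have hU : IsOpen U := isOpen_lt continuous_const continuous_norm
  have hU0 : U ⊆ {z : ℂ | z ≠ 0} := fun z hz => ne_zero_of_half_le_norm (le_of_lt hz)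
  -- term 1 : `χ • g₀`
  have h1 : MemContDiffHolder k r fun z =>
      ContinuousLinearMap.lsmul ℝ ℝ (chiCut z) (p.1 z) :=
    (MemContDiffHolder.of_contDiff_of_hasCompactSupport contDiff_chiCut hasCompactSupport_chiCut
      hr).bilinear hr (ContinuousLinearMap.lsmul ℝ ℝ) p.1.memContDiffHolder
  -- term 2 : `χ₁ • (g₁ ∘ inv)`, then times the smooth coefficient `(τ z⁻¹)⁻¹`
  have h2 : MemContDiffHolder k r fun z => (rhoCut₄ z * (1 - chiCut z)) • p.2 z⁻¹ :=
    MemContDiffHolder.smul_comp_of_contDiffOn hr p.2.memContDiffHolder hU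
      (contDiffOn_inv.mono hU0) contDiff_rhoCut₄_mul_one_sub_chiCut
      (hasCompactSupport_rhoCut₄.mul_right) tsupport_rhoCut₄_mul_one_sub_chiCut_subset
  have h2s : HasCompactSupport fun z : ℂ => (rhoCut₄ z * (1 - chiCut z)) • p.2 z⁻¹ :=
    (hasCompactSupport_rhoCut₄.mul_right (f' := fun z => 1 - chiCut z)).smul_right
      (f' := fun z => p.2 z⁻¹)
  have h2U : tsupport (fun z : ℂ => (rhoCut₄ z * (1 - chiCut z)) • p.2 z⁻¹) ⊆ U :=
    (tsupport_smul_subset_left _ _).trans tsupport_rhoCut₄_mul_one_sub_chiCut_subset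
  have hb : ContDiffOn ℝ ∞ (fun z : ℂ => (τ z⁻¹)⁻¹) U := by
    intro z hz
    have hz0 : z ≠ 0 := hU0 hz
    have hτz : ContDiffAt ℝ ∞ τ z⁻¹ :=
      (hτs z⁻¹ (inv_ne_zero hz0)).contDiffAt (isOpen_ne_zero.mem_nhds (inv_ne_zero hz0))
    exact ((hτz.comp z ((contDiffAt_inv ℂ hz0).restrict_scalars ℝ)).inv
      (hτ _ (inv_ne_zero hz0))).contDiffWithinAt
  have h3 : MemContDiffHolder k r fun z : ℂ =>
      (τ z⁻¹)⁻¹ • ((rhoCut₄ z * (1 - chiCut z)) • p.2 z⁻¹) :=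
    memContDiffHolder_smul_of_contDiffOn hr h2 h2s hU hb h2U
  -- the sum is the function in question
  have heq : (fun z => (rhoCut₄ z : ℂ) • sec₀ τ p z) =
      (fun z => ContinuousLinearMap.lsmul ℝ ℝ (chiCut z) (p.1 z)) + fun z : ℂ =>
        (τ z⁻¹)⁻¹ • ((rhoCut₄ z * (1 - chiCut z)) • p.2 z⁻¹) := by
    funext z
    simp only [Pi.add_apply, ContinuousLinearMap.lsmul_apply]
    by_cases hz1 : ‖z‖ ≤ 1
    · rw [chiCut_eq_one hz1, rhoCut₄_eq_one (by linarith), sec₀_of_norm_lt (by linarith)]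
      simp
    · have hz : 2⁻¹ < ‖z‖ := lt_of_lt_of_le (by norm_num) (not_le.1 hz1).le
      rw [fst_eq_rhoCut_smul_sec₀ hp z, sec₀_of_half_lt hp hz]
      by_cases hz2 : 3 / 2 ≤ ‖z‖
      · rw [chiCut_eq_zero hz2]
        simp only [zero_smul, zero_add, sub_zero, mul_one]
        rw [← Complex.coe_smul, smul_comm]
      · have hz2' : ‖z‖ < 3 / 2 := not_le.1 hz2
        rw [rhoCut_eq_one (by linarith), rhoCut₄_eq_one (by linarith)]
        simp only [Complex.ofReal_one, one_smul, one_mul]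
        rw [smul_comm (τ z⁻¹)⁻¹ (1 - chiCut z), ← add_smul, add_sub_cancel, one_smul]
  rw [heq]
  exact h1.add h3

/-- **The `w`-representative cut off at radius `4`/`5` is in `C^{k,r}_b`.** [cite: Joyce2007, §1.2] -/
theorem memContDiffHolder_rhoCut₄_smul_sec₁ (hp : p ∈ holderSections F τ k r)
    (hτs : ContDiffOn ℝ ∞ τ {w | w ≠ 0}) (hr : r ≤ 1) :
    MemContDiffHolder k r fun w => (rhoCut₄ w : ℂ) • sec₁ τ p w := by
  set U : Set ℂ := {z | 2⁻¹ < ‖z‖}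
  have hU : IsOpen U := isOpen_lt continuous_const continuous_norm
  have hU0 : U ⊆ {z : ℂ | z ≠ 0} := fun z hz => ne_zero_of_half_le_norm (le_of_lt hz)
  have h1 : MemContDiffHolder k r fun w =>
      ContinuousLinearMap.lsmul ℝ ℝ (chiCut w) (p.2 w) :=
    (MemContDiffHolder.of_contDiff_of_hasCompactSupport contDiff_chiCut hasCompactSupport_chiCut
      hr).bilinear hr (ContinuousLinearMap.lsmul ℝ ℝ) p.2.memContDiffHolder
  have h2 : MemContDiffHolder k r fun w => (rhoCut₄ w * (1 - chiCut w)) • p.1 w⁻¹ :=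
    MemContDiffHolder.smul_comp_of_contDiffOn hr p.1.memContDiffHolder hU
      (contDiffOn_inv.mono hU0) contDiff_rhoCut₄_mul_one_sub_chiCut
      (hasCompactSupport_rhoCut₄.mul_right) tsupport_rhoCut₄_mul_one_sub_chiCut_subset
  have h2s : HasCompactSupport fun w : ℂ => (rhoCut₄ w * (1 - chiCut w)) • p.1 w⁻¹ :=
    (hasCompactSupport_rhoCut₄.mul_right (f' := fun z => 1 - chiCut z)).smul_right
      (f' := fun w => p.1 w⁻¹)
  have h2U : tsupport (fun w : ℂ => (rhoCut₄ w * (1 - chiCut w)) • p.1 w⁻¹) ⊆ U :=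
    (tsupport_smul_subset_left _ _).trans tsupport_rhoCut₄_mul_one_sub_chiCut_subset
  have hb : ContDiffOn ℝ ∞ τ U := hτs.mono hU0
  have h3 : MemContDiffHolder k r fun w : ℂ =>
      τ w • ((rhoCut₄ w * (1 - chiCut w)) • p.1 w⁻¹) :=
    memContDiffHolder_smul_of_contDiffOn hr h2 h2s hU hb h2U
  have heq : (fun w => (rhoCut₄ w : ℂ) • sec₁ τ p w) =
      (fun w => ContinuousLinearMap.lsmul ℝ ℝ (chiCut w) (p.2 w)) + fun w : ℂ =>
        τ w • ((rhoCut₄ w * (1 - chiCut w)) • p.1 w⁻¹) := by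
    funext w
    simp only [Pi.add_apply, ContinuousLinearMap.lsmul_apply]
    by_cases hw1 : ‖w‖ ≤ 1
    · rw [chiCut_eq_one hw1, rhoCut₄_eq_one (by linarith), sec₁_of_norm_lt (by linarith)]
      simp
    · have hw : 2⁻¹ < ‖w‖ := lt_of_lt_of_le (by norm_num) (not_le.1 hw1).le
      rw [snd_eq_rhoCut_smul_sec₁ hp w, sec₁_of_half_lt hp hw]
      by_cases hw2 : 3 / 2 ≤ ‖w‖
      · rw [chiCut_eq_zero hw2]
        simp only [zero_smul, zero_add, sub_zero, mul_one]
        rw [← Complex.coe_smul, smul_comm]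
      · have hw2' : ‖w‖ < 3 / 2 := not_le.1 hw2
        rw [rhoCut_eq_one (by linarith), rhoCut₄_eq_one (by linarith)]
        simp only [Complex.ofReal_one, one_smul, one_mul]
        rw [smul_comm (τ w) (1 - chiCut w), ← add_smul, add_sub_cancel, one_smul]
  rw [heq]
  exact h1.add h3

end CutSec

/-! ### The cut-off representatives as bounded operators -/

/-- The cut-off `z`-representative `ρ₄ • sec₀ p ∈ C^{k,r}_b(ℂ, F)` of a member `p`. [folklore] -/
def cutSec₀ (hτ : ∀ w, w ≠ 0 → τ w ≠ 0) (hτs : ContDiffOn ℝ ∞ τ {w | w ≠ 0}) (hr : r ≤ 1)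
    (p : holderSections F τ k r) : ContDiffHolderFunction ℂ F k r :=
  ⟨fun z => (rhoCut₄ z : ℂ) • sec₀ τ (p : ContDiffHolderFunction ℂ F k r ×
    ContDiffHolderFunction ℂ F k r) z, memContDiffHolder_rhoCut₄_smul_sec₀ p.2 hτ hτs hr⟩

/-- Pointwise: `cutSec₀ p z = ρ₄ z • sec₀ p z`. [folklore] -/
@[simp]
theorem cutSec₀_apply (hτ : ∀ w, w ≠ 0 → τ w ≠ 0) (hτs : ContDiffOn ℝ ∞ τ {w | w ≠ 0})
    (hr : r ≤ 1) (p : holderSections F τ k r) (z : ℂ) :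
    cutSec₀ hτ hτs hr p z = (rhoCut₄ z : ℂ) • sec₀ τ (p : ContDiffHolderFunction ℂ F k r ×
      ContDiffHolderFunction ℂ F k r) z := rfl

/-- The cut-off `w`-representative `ρ₄ • sec₁ p ∈ C^{k,r}_b(ℂ, F)` of a member `p`. [folklore] -/
def cutSec₁ (hτs : ContDiffOn ℝ ∞ τ {w | w ≠ 0}) (hr : r ≤ 1)
    (p : holderSections F τ k r) : ContDiffHolderFunction ℂ F k r :=
  ⟨fun w => (rhoCut₄ w : ℂ) • sec₁ τ (p : ContDiffHolderFunction ℂ F k r ×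
    ContDiffHolderFunction ℂ F k r) w, memContDiffHolder_rhoCut₄_smul_sec₁ p.2 hτs hr⟩

/-- Pointwise: `cutSec₁ p w = ρ₄ w • sec₁ p w`. [folklore] -/
@[simp]
theorem cutSec₁_apply (hτs : ContDiffOn ℝ ∞ τ {w | w ≠ 0}) (hr : r ≤ 1)
    (p : holderSections F τ k r) (w : ℂ) :
    cutSec₁ hτs hr p w = (rhoCut₄ w : ℂ) • sec₁ τ (p : ContDiffHolderFunction ℂ F k r ×
      ContDiffHolderFunction ℂ F k r) w := rfl

/-- `cutSec₀` as a linear map. [folklore] -/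
def cutSec₀ₗ (hτ : ∀ w, w ≠ 0 → τ w ≠ 0) (hτs : ContDiffOn ℝ ∞ τ {w | w ≠ 0}) (hr : r ≤ 1) :
    holderSections F τ k r →ₗ[ℝ] ContDiffHolderFunction ℂ F k r where
  toFun := cutSec₀ hτ hτs hr
  map_add' p q := ContDiffHolderFunction.ext fun z => by
    simp [sec₀_add, smul_add]
  map_smul' c p := ContDiffHolderFunction.ext fun z => by
    simp [sec₀_smul, smul_comm c]

/-- `cutSec₁` as a linear map. [folklore] -/
def cutSec₁ₗ (hτs : ContDiffOn ℝ ∞ τ {w | w ≠ 0}) (hr : r ≤ 1) :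
    holderSections F τ k r →ₗ[ℝ] ContDiffHolderFunction ℂ F k r where
  toFun := cutSec₁ hτs hr
  map_add' p q := ContDiffHolderFunction.ext fun w => by
    simp [sec₁_add, smul_add]
  map_smul' c p := ContDiffHolderFunction.ext fun w => by
    simp [sec₁_smul, smul_comm c]

variable [CompleteSpace F]

/-- **The cut-off `z`-representative as a bounded operator** `𝓗^{k,r}_τ →L[ℝ] C^{k,r}_b(ℂ, F)`
(closed graph: its point evaluations are `p ↦ ρ₄ z • g₀ z` or `p ↦ ρ₄ z • (τ z⁻¹)⁻¹ • g₁ z⁻¹`).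
[folklore] -/
def cutSec₀CLM (hτ : ∀ w, w ≠ 0 → τ w ≠ 0) (hτs : ContDiffOn ℝ ∞ τ {w | w ≠ 0}) (hr : r ≤ 1) :
    holderSections F τ k r →L[ℝ] ContDiffHolderFunction ℂ F k r :=
  ContDiffHolderFunction.clmOfContinuousEval (cutSec₀ₗ hτ hτs hr) fun z => by
    change Continuous fun p : holderSections F τ k r => (rhoCut₄ z : ℂ) •
      sec₀ τ (p : ContDiffHolderFunction ℂ F k r × ContDiffHolderFunction ℂ F k r) z
    have h1 : Continuous fun p : holderSections F τ k r =>
        (p : ContDiffHolderFunction ℂ F k r × ContDiffHolderFunction ℂ F k r).1 z :=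
      (ContDiffHolderFunction.evalCLM (E := ℂ) (F := F) (k := k) (r := r) z).continuous.comp
        (continuous_fst.comp continuous_subtype_val)
    have h2 : Continuous fun p : holderSections F τ k r =>
        (p : ContDiffHolderFunction ℂ F k r × ContDiffHolderFunction ℂ F k r).2 z⁻¹ :=
      (ContDiffHolderFunction.evalCLM (E := ℂ) (F := F) (k := k) (r := r) z⁻¹).continuous.comp
        (continuous_snd.comp continuous_subtype_val)
    by_cases hz : ‖z‖ < 2
    · simp only [sec₀, hz, if_true]
      exact h1.const_smul _
    · simp only [sec₀, hz, if_false]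
      exact (h2.const_smul _).const_smul _

/-- Pointwise: `cutSec₀CLM p z = ρ₄ z • sec₀ p z`. [folklore] -/
@[simp]
theorem cutSec₀CLM_apply (hτ : ∀ w, w ≠ 0 → τ w ≠ 0) (hτs : ContDiffOn ℝ ∞ τ {w | w ≠ 0})
    (hr : r ≤ 1) (p : holderSections F τ k r) (z : ℂ) :
    cutSec₀CLM hτ hτs hr p z = (rhoCut₄ z : ℂ) • sec₀ τ (p : ContDiffHolderFunction ℂ F k r ×
      ContDiffHolderFunction ℂ F k r) z := rfl

/-- On the disc `‖z‖ ≤ 4`, `cutSec₀CLM p` is the `z`-representative. [folklore] -/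
theorem cutSec₀CLM_apply_of_norm_le (hτ : ∀ w, w ≠ 0 → τ w ≠ 0)
    (hτs : ContDiffOn ℝ ∞ τ {w | w ≠ 0}) (hr : r ≤ 1) (p : holderSections F τ k r) {z : ℂ}
    (hz : ‖z‖ ≤ 4) : cutSec₀CLM hτ hτs hr p z = sec₀ τ (p : ContDiffHolderFunction ℂ F k r ×
      ContDiffHolderFunction ℂ F k r) z := by
  rw [cutSec₀CLM_apply, rhoCut₄_eq_one hz, Complex.ofReal_one, one_smul]

/-- **The cut-off `w`-representative as a bounded operator** `𝓗^{k,r}_τ →L[ℝ] C^{k,r}_b(ℂ, F)`.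
[folklore] -/
def cutSec₁CLM (hτs : ContDiffOn ℝ ∞ τ {w | w ≠ 0}) (hr : r ≤ 1) :
    holderSections F τ k r →L[ℝ] ContDiffHolderFunction ℂ F k r :=
  ContDiffHolderFunction.clmOfContinuousEval (cutSec₁ₗ hτs hr) fun w => by
    change Continuous fun p : holderSections F τ k r => (rhoCut₄ w : ℂ) •
      sec₁ τ (p : ContDiffHolderFunction ℂ F k r × ContDiffHolderFunction ℂ F k r) w
    have h1 : Continuous fun p : holderSections F τ k r =>
        (p : ContDiffHolderFunction ℂ F k r × ContDiffHolderFunction ℂ F k r).2 w :=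
      (ContDiffHolderFunction.evalCLM (E := ℂ) (F := F) (k := k) (r := r) w).continuous.comp
        (continuous_snd.comp continuous_subtype_val)
    have h2 : Continuous fun p : holderSections F τ k r =>
        (p : ContDiffHolderFunction ℂ F k r × ContDiffHolderFunction ℂ F k r).1 w⁻¹ :=
      (ContDiffHolderFunction.evalCLM (E := ℂ) (F := F) (k := k) (r := r) w⁻¹).continuous.comp
        (continuous_fst.comp continuous_subtype_val)
    by_cases hw : ‖w‖ < 2
    · simp only [sec₁, hw, if_true]
      exact h1.const_smul _
    · simp only [sec₁, hw, if_false]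
      exact (h2.const_smul _).const_smul _

/-- Pointwise: `cutSec₁CLM p w = ρ₄ w • sec₁ p w`. [folklore] -/
@[simp]
theorem cutSec₁CLM_apply (hτs : ContDiffOn ℝ ∞ τ {w | w ≠ 0}) (hr : r ≤ 1)
    (p : holderSections F τ k r) (w : ℂ) :
    cutSec₁CLM hτs hr p w = (rhoCut₄ w : ℂ) • sec₁ τ (p : ContDiffHolderFunction ℂ F k r ×
      ContDiffHolderFunction ℂ F k r) w := rfl

/-- On the disc `‖w‖ ≤ 4`, `cutSec₁CLM p` is the `w`-representative. [folklore] -/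
theorem cutSec₁CLM_apply_of_norm_le (hτs : ContDiffOn ℝ ∞ τ {w | w ≠ 0}) (hr : r ≤ 1)
    (p : holderSections F τ k r) {w : ℂ} (hw : ‖w‖ ≤ 4) :
    cutSec₁CLM hτs hr p w = sec₁ τ (p : ContDiffHolderFunction ℂ F k r ×
      ContDiffHolderFunction ℂ F k r) w := by
  rw [cutSec₁CLM_apply, rhoCut₄_eq_one hw, Complex.ofReal_one, one_smul]

/-! ### `∂̄` on `C^{k+1,r}_b(ℂ, F)` -/

/-- **`∂̄ = ½ (∂ₓ + i ∂_y)` as a bounded operator `C^{k+1,r}_b(ℂ, F) →L[ℝ] C^{k,r}_b(ℂ, F)`**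
(a combination of the directional-derivative operators `fderivApplyCLM`). [folklore] -/
def dbarCLM : ContDiffHolderFunction ℂ F (k + 1) r →L[ℝ] ContDiffHolderFunction ℂ F k r :=
  (2⁻¹ : ℝ) • (ContDiffHolderFunction.fderivApplyCLM 1 +
    (ContDiffHolderFunction.postcompCLM (ContinuousLinearMap.lsmul ℝ ℂ I : F →L[ℝ] F)).comp
      (ContDiffHolderFunction.fderivApplyCLM I))

/-- Pointwise: `dbarCLM u z = ∂̄ u (z)` (`= dbarAlong 1 u z`). [folklore] -/
@[simp]
theorem dbarCLM_apply (u : ContDiffHolderFunction ℂ F (k + 1) r) (z : ℂ) :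
    dbarCLM u z = dbarAlong 1 (u : ℂ → F) z := by
  rw [dbarAlong_one, dbarCLM]
  simp only [smul_apply, add_apply,
    ContinuousLinearMap.coe_comp, comp_apply, ContDiffHolderFunction.coe_smul,
    ContDiffHolderFunction.coe_add, Pi.smul_apply, Pi.add_apply,
    ContDiffHolderFunction.fderivApplyCLM_apply, ContDiffHolderFunction.postcompCLM_apply,
    ContinuousLinearMap.lsmul_apply]
  rw [← Complex.coe_smul]
  norm_num

/-! ### The operator `∂̄ : 𝓗^{k+1,r}_τ → 𝓗^{k,r}_{dbarClutch τ}` -/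

/-- The first piece `ρ • ∂̄ (ρ₄ • sec₀ p)` of `∂̄ p`, as a bounded operator
`𝓗^{k+1,r}_τ →L[ℝ] C^{k,r}_b(ℂ, F)`. [folklore] -/
def dbarPiece₀CLM (hτ : ∀ w, w ≠ 0 → τ w ≠ 0) (hτs : ContDiffOn ℝ ∞ τ {w | w ≠ 0})
    (hr : r ≤ 1) : holderSections F τ (k + 1) r →L[ℝ] ContDiffHolderFunction ℂ F k r :=
  (ContDiffHolderFunction.coeffCLM hr rhoCut contDiff_rhoCut hasCompactSupport_rhoCut).comp
    (dbarCLM.comp (cutSec₀CLM hτ hτs hr))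

/-- The second piece `ρ • ∂̄ (ρ₄ • sec₁ p)` of `∂̄ p`, as a bounded operator
`𝓗^{k+1,r}_τ →L[ℝ] C^{k,r}_b(ℂ, F)`. [folklore] -/
def dbarPiece₁CLM (hτs : ContDiffOn ℝ ∞ τ {w | w ≠ 0}) (hr : r ≤ 1) :
    holderSections F τ (k + 1) r →L[ℝ] ContDiffHolderFunction ℂ F k r :=
  (ContDiffHolderFunction.coeffCLM hr rhoCut contDiff_rhoCut hasCompactSupport_rhoCut).comp
    (dbarCLM.comp (cutSec₁CLM hτs hr))

/-- **Pointwise formula for the first piece**: `ρ z • ∂̄ (sec₀ p) (z)` (`∂̄` is local and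
`ρ₄ = 1` near the support of `ρ`). [folklore] -/
theorem dbarPiece₀CLM_apply (hτ : ∀ w, w ≠ 0 → τ w ≠ 0) (hτs : ContDiffOn ℝ ∞ τ {w | w ≠ 0})
    (hr : r ≤ 1) (p : holderSections F τ (k + 1) r) (z : ℂ) :
    dbarPiece₀CLM hτ hτs hr p z = (rhoCut z : ℂ) • dbarAlong 1 (sec₀ τ
      (p : ContDiffHolderFunction ℂ F (k + 1) r × ContDiffHolderFunction ℂ F (k + 1) r)) z := by
  simp only [dbarPiece₀CLM, ContinuousLinearMap.coe_comp, comp_apply,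
    ContDiffHolderFunction.coeffCLM_apply, dbarCLM_apply]
  by_cases hρ : rhoCut z = 0
  · simp [hρ]
  · have hz3 : ‖z‖ < 3 := norm_lt_three_of_rhoCut_ne_zero hρ
    have hev : ((cutSec₀CLM hτ hτs hr p : ContDiffHolderFunction ℂ F (k + 1) r) : ℂ → F)
        =ᶠ[𝓝 z] sec₀ τ (p : ContDiffHolderFunction ℂ F (k + 1) r ×
          ContDiffHolderFunction ℂ F (k + 1) r) := by
      filter_upwards [(isOpen_lt continuous_norm continuous_const).mem_nhds
        (show ‖z‖ < 4 by linarith)] with y hy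
      exact cutSec₀CLM_apply_of_norm_le hτ hτs hr p hy.le
    rw [dbarAlong_congr_of_eventuallyEq hev, Complex.coe_smul]

/-- **Pointwise formula for the second piece**: `ρ w • ∂̄ (sec₁ p) (w)`. [folklore] -/
theorem dbarPiece₁CLM_apply (hτs : ContDiffOn ℝ ∞ τ {w | w ≠ 0}) (hr : r ≤ 1)
    (p : holderSections F τ (k + 1) r) (w : ℂ) :
    dbarPiece₁CLM hτs hr p w = (rhoCut w : ℂ) • dbarAlong 1 (sec₁ τ
      (p : ContDiffHolderFunction ℂ F (k + 1) r × ContDiffHolderFunction ℂ F (k + 1) r)) w := by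
  simp only [dbarPiece₁CLM, ContinuousLinearMap.coe_comp, comp_apply,
    ContDiffHolderFunction.coeffCLM_apply, dbarCLM_apply]
  by_cases hρ : rhoCut w = 0
  · simp [hρ]
  · have hw3 : ‖w‖ < 3 := norm_lt_three_of_rhoCut_ne_zero hρ
    have hev : ((cutSec₁CLM hτs hr p : ContDiffHolderFunction ℂ F (k + 1) r) : ℂ → F)
        =ᶠ[𝓝 w] sec₁ τ (p : ContDiffHolderFunction ℂ F (k + 1) r ×
          ContDiffHolderFunction ℂ F (k + 1) r) := by
      filter_upwards [(isOpen_lt continuous_norm continuous_const).mem_nhds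
        (show ‖w‖ < 4 by linarith)] with y hy
      exact cutSec₁CLM_apply_of_norm_le hτs hr p hy.le
    rw [dbarAlong_congr_of_eventuallyEq hev, Complex.coe_smul]

/-- The pair of pieces `(ρ • ∂̄ sec₀ p, ρ • ∂̄ sec₁ p)` satisfies the piece relations of the
bundle `dbarClutch τ` (by `dbarAlong_sec₁`). [folklore] -/
theorem dbarPiece_mem (hτ : ∀ w, w ≠ 0 → τ w ≠ 0) (hτh : DifferentiableOn ℂ τ {w | w ≠ 0})
    (hr : r ≤ 1) (p : holderSections F τ (k + 1) r) :
    (dbarPiece₀CLM hτ (contDiffOn_real_of_differentiableOn hτh) hr p,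
      dbarPiece₁CLM (contDiffOn_real_of_differentiableOn hτh) hr p) ∈
      holderSections F (dbarClutch τ) k r := by
  refine ⟨fun z hz => ?_, fun w hw => ?_⟩
  · have hz0 : z ≠ 0 := ne_zero_of_half_le_norm hz
    have hσ : dbarClutch τ z⁻¹ ≠ 0 := dbarClutch_ne_zero (hτ _ (inv_ne_zero hz0)) (inv_ne_zero hz0)
    change dbarPiece₀CLM hτ _ hr p z = _ • dbarPiece₁CLM _ hr p z⁻¹
    rw [dbarPiece₀CLM_apply, dbarPiece₁CLM_apply, rhoCut_eq_one (norm_inv_le_two_of_half_le hz),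
      dbarAlong_sec₁ p.2 hτ hτh (inv_ne_zero hz0), inv_inv, Complex.ofReal_one, one_smul,
      smul_smul, mul_assoc, inv_mul_cancel₀ hσ, mul_one]
  · have hw0 : w ≠ 0 := ne_zero_of_half_le_norm hw
    change dbarPiece₁CLM _ hr p w = _ • dbarPiece₀CLM hτ _ hr p w⁻¹
    rw [dbarPiece₀CLM_apply, dbarPiece₁CLM_apply, rhoCut_eq_one (norm_inv_le_two_of_half_le hw),
      dbarAlong_sec₁ p.2 hτ hτh hw0, Complex.ofReal_one, one_smul, smul_smul]

/-- **The Cauchy–Riemann operator `∂̄ : 𝓗^{k+1,r}_τ →L[ℝ] 𝓗^{k,r}_{dbarClutch τ}`** on Hölder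
sections of the line bundle with holomorphic, zero-free clutching function `τ` over the Riemann
sphere (`r ≤ 1`): in the two charts it is `∂/∂z̄` and `∂/∂w̄` of the representatives
(`sec₀_dbarSec`, `sec₁_dbarSec`), its pieces being `(ρ • ∂̄ sec₀ p, ρ • ∂̄ sec₁ p)`.
[cite: Wendl2018, §2.1.3] -/
def dbarSec (hτ : ∀ w, w ≠ 0 → τ w ≠ 0) (hτh : DifferentiableOn ℂ τ {w | w ≠ 0}) (hr : r ≤ 1) :
    holderSections F τ (k + 1) r →L[ℝ] holderSections F (dbarClutch τ) k r :=
  ((dbarPiece₀CLM hτ (contDiffOn_real_of_differentiableOn hτh) hr).prod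
    (dbarPiece₁CLM (contDiffOn_real_of_differentiableOn hτh) hr)).codRestrict
      (holderSections F (dbarClutch τ) k r) (dbarPiece_mem hτ hτh hr)

section DbarSec

variable {hτ : ∀ w, w ≠ 0 → τ w ≠ 0} {hτh : DifferentiableOn ℂ τ {w | w ≠ 0}} {hr : r ≤ 1}

/-- The pair of pieces of `∂̄ p` is `(dbarPiece₀CLM p, dbarPiece₁CLM p)`. [folklore] -/
theorem dbarSec_coe (p : holderSections F τ (k + 1) r) :
    ((dbarSec hτ hτh hr p : holderSections F (dbarClutch τ) k r) :
      ContDiffHolderFunction ℂ F k r × ContDiffHolderFunction ℂ F k r) =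
      (dbarPiece₀CLM hτ (contDiffOn_real_of_differentiableOn hτh) hr p,
        dbarPiece₁CLM (contDiffOn_real_of_differentiableOn hτh) hr p) := rfl

/-- **The first piece of `∂̄ p` is `ρ • ∂̄ (sec₀ p)`.** [folklore] -/
@[simp]
theorem dbarSec_fst_apply (p : holderSections F τ (k + 1) r) (z : ℂ) :
    ((dbarSec hτ hτh hr p : holderSections F (dbarClutch τ) k r) :
      ContDiffHolderFunction ℂ F k r × ContDiffHolderFunction ℂ F k r).1 z =
      (rhoCut z : ℂ) • dbarAlong 1 (sec₀ τ (p : ContDiffHolderFunction ℂ F (k + 1) r ×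
        ContDiffHolderFunction ℂ F (k + 1) r)) z :=
  dbarPiece₀CLM_apply hτ _ hr p z

/-- **The second piece of `∂̄ p` is `ρ • ∂̄ (sec₁ p)`.** [folklore] -/
@[simp]
theorem dbarSec_snd_apply (p : holderSections F τ (k + 1) r) (w : ℂ) :
    ((dbarSec hτ hτh hr p : holderSections F (dbarClutch τ) k r) :
      ContDiffHolderFunction ℂ F k r × ContDiffHolderFunction ℂ F k r).2 w =
      (rhoCut w : ℂ) • dbarAlong 1 (sec₁ τ (p : ContDiffHolderFunction ℂ F (k + 1) r ×
        ContDiffHolderFunction ℂ F (k + 1) r)) w :=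
  dbarPiece₁CLM_apply _ hr p w

/-- **Chart formula, `z`-chart**: the `z`-representative of `∂̄ p` is `∂/∂z̄` of the
`z`-representative of `p`, on all of `ℂ`. [cite: Wendl2018, §2.1.3] -/
theorem sec₀_dbarSec (p : holderSections F τ (k + 1) r) (z : ℂ) :
    sec₀ (dbarClutch τ) ((dbarSec hτ hτh hr p : holderSections F (dbarClutch τ) k r) :
      ContDiffHolderFunction ℂ F k r × ContDiffHolderFunction ℂ F k r) z =
      dbarAlong 1 (sec₀ τ (p : ContDiffHolderFunction ℂ F (k + 1) r ×
        ContDiffHolderFunction ℂ F (k + 1) r)) z := by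
  by_cases h2 : ‖z‖ < 2
  · rw [sec₀_of_norm_lt h2, dbarSec_fst_apply, rhoCut_eq_one h2.le, Complex.ofReal_one, one_smul]
  · have hz : 2⁻¹ < ‖z‖ := lt_of_lt_of_le (by norm_num) (not_lt.1 h2)
    have hz0 : z ≠ 0 := ne_zero_of_half_le_norm hz.le
    rw [sec₀_of_half_lt (dbarSec hτ hτh hr p).2 hz, dbarSec_snd_apply,
      rhoCut_eq_one (norm_inv_le_two_of_half_le hz.le), Complex.ofReal_one, one_smul,
      dbarAlong_sec₀ p.2 hτ hτh hz0]

/-- **Chart formula, `w`-chart**: the `w`-representative of `∂̄ p` is `∂/∂w̄` of the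
`w`-representative of `p`, on all of `ℂ`. [cite: Wendl2018, §2.1.3] -/
theorem sec₁_dbarSec (p : holderSections F τ (k + 1) r) (w : ℂ) :
    sec₁ (dbarClutch τ) ((dbarSec hτ hτh hr p : holderSections F (dbarClutch τ) k r) :
      ContDiffHolderFunction ℂ F k r × ContDiffHolderFunction ℂ F k r) w =
      dbarAlong 1 (sec₁ τ (p : ContDiffHolderFunction ℂ F (k + 1) r ×
        ContDiffHolderFunction ℂ F (k + 1) r)) w := by
  by_cases h2 : ‖w‖ < 2
  · rw [sec₁_of_norm_lt h2, dbarSec_snd_apply, rhoCut_eq_one h2.le, Complex.ofReal_one, one_smul]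
  · have hw : 2⁻¹ < ‖w‖ := lt_of_lt_of_le (by norm_num) (not_lt.1 h2)
    have hw0 : w ≠ 0 := ne_zero_of_half_le_norm hw.le
    rw [sec₁_of_half_lt (dbarSec hτ hτh hr p).2 hw, dbarSec_fst_apply,
      rhoCut_eq_one (norm_inv_le_two_of_half_le hw.le), Complex.ofReal_one, one_smul,
      dbarAlong_sec₁ p.2 hτ hτh hw0]

/-- `∂̄ p` read through the evaluation functional of the `z`-chart: for `‖z₀‖ < 2`,
`eval₀CLM z₀ (∂̄ p) = ∂̄ (sec₀ p) (z₀)`. [folklore] -/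
theorem eval₀CLM_dbarSec {z₀ : ℂ} (hz₀ : ‖z₀‖ < 2) (p : holderSections F τ (k + 1) r) :
    eval₀CLM (F := F) (dbarClutch τ) k r z₀ (dbarSec hτ hτh hr p) =
      dbarAlong 1 (sec₀ τ (p : ContDiffHolderFunction ℂ F (k + 1) r ×
        ContDiffHolderFunction ℂ F (k + 1) r)) z₀ := by
  rw [eval₀CLM_eq_sec₀ hz₀, sec₀_dbarSec]

end DbarSec

/-- **`∂̄` of a smooth section, computed in `𝓗`**: `dbarSec (s.toHolder) = (s.dbar).toHolder`.
[folklore] -/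
theorem dbarSec_toHolder (hτ : ∀ w, w ≠ 0 → τ w ≠ 0) (hτh : DifferentiableOn ℂ τ {w | w ≠ 0})
    (hr : r ≤ 1) (s : SmoothSection F τ) :
    dbarSec hτ hτh hr (s.toHolder (k := k + 1) hτ hr) =
      (s.dbar hτh).toHolder (dbarClutch_ne_zero_of hτ) hr := by
  have h₀ : sec₀ τ (s.toHolder (k := k + 1) hτ hr : ContDiffHolderFunction ℂ F (k + 1) r ×
      ContDiffHolderFunction ℂ F (k + 1) r) = s.f₀ := funext (s.sec₀_toHolder hτ hr)
  have h₁ : sec₁ τ (s.toHolder (k := k + 1) hτ hr : ContDiffHolderFunction ℂ F (k + 1) r ×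
      ContDiffHolderFunction ℂ F (k + 1) r) = s.f₁ := funext (s.sec₁_toHolder hτ hr)
  apply Subtype.ext
  apply Prod.ext
  · exact ContDiffHolderFunction.ext fun z => by
      rw [dbarSec_fst_apply, SmoothSection.toHolder_fst_apply, h₀, SmoothSection.dbar_f₀]
  · exact ContDiffHolderFunction.ext fun w => by
      rw [dbarSec_snd_apply, SmoothSection.toHolder_snd_apply, h₁, SmoothSection.dbar_f₁]

end Sections

end RiemannSphere

end Literature.Analysis.Complex

end
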